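import Literature.NumberTheory.Sieve.ParityBarrier
import Literature.NumberTheory.Sieve.PrimePowersInProgressions
import HarnessLib

/-!
# The Möbius two-point log-Chowla estimate from the Liouville one (squarefree sieve)

Trunk/family: Literature ▸ NumberTheory ▸ LFunctions (parity.S21, Tao 2016).

This file PROVES the implication

* `Literature.Parity.tao_log_chowla_moebius_of_liouville :
    Literature.Parity.tao_log_chowla_liouville → Literature.Parity.tao_log_chowla_moebius`,

i.e. the named fact `Literature.NumberTheory.Sieve.tao_log_chowla_moebius` of `ParityWave0`
(`∑_{n ≤ x} μ(n) μ(n+h) / n = o(log x)` for every `h ≥ 1`; Tao, Forum Math. Pi 4 (2016) e8, §1,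
paragraph after Remark 1.6) follows from the named fact `Literature.NumberTheory.Sieve.tao_log_chowla_liouville`
(Tao 2016, Thm 1.2 / Cor 1.5 for `λ` along linear forms `a₁ n + b₁`, `a₂ n + b₂`, `a₁ b₂ ≠ a₂ b₁`).

Tao (2016, §1) obtains the Möbius statement from Corollary 1.5 applied to `g₁ = g₂ = μ` (the
non-pretentiousness hypothesis (1.8) only sees primes, where `μ = λ`). Here we give instead the
elementary reduction to the *Liouville* statement along linear forms, so that the two wave-0 facts
share one frontier:

1. `μ(n) = λ(n) 𝟙_{sf}(n)` and `𝟙_{sf}(n) = ∑_{d² ∣ n} μ(d)` (`Nat.sq_mul_squarefree_of_pos`,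
   `∑_{d ∣ b} μ(d) = [b = 1]`), so
   `∑_{n ≤ x} μ(n)μ(n+h)/n = ∑_{d, e} μ(d) μ(e) T_{d,e}^h(x)` with
   `T_{d,e}^h(x) = ∑_{n ≤ x, d² ∣ n, e² ∣ n+h} λ(n)λ(n+h)/n` (`Literature.NumberTheory.LFunctions.sievedCorr`).
2. Truncation `d ≤ D`, `e ≤ E`: the tails are `≤ (2 + log x)/D` and `≤ D (3 + log x)/E`
   (`abs_tailD_le`, `abs_tailE_le`), using a harmonic-sum bound over `q`-separated sets
   (`sum_one_div_le_of_separated`) and `∑_{k > D} 1/k² ≤ 1/D`.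
3. For fixed `d, e ≥ 1` the conditions `d² ∣ n`, `e² ∣ n + h` cut out a union of at most `L`
   residue classes `n ≡ c (mod L)`, `L = lcm(d², e²)`; writing `n = L k + c` and replacing the
   weight `1/(Lk + c)` by `1/(Lk)` at cost `O(1)`, each class contributes
   `(1/L) ∑_k λ(Lk + c) λ(Lk + c + h)/k + O(1)`, which is `o(log x)` by
   `tao_log_chowla_liouville` with `(a₁, a₂, b₁, b₂) = (L, L, c, c + h)` (`L (c+h) ≠ L c` as `h ≥ 1`)
   (`sievedCorr_isLittleO`, `mainDE_isLittleO`).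
4. Choosing `D = ⌈8/ε⌉`, `E = max(2h, ⌈8D/ε⌉)` gives `|∑_{n ≤ x} μ(n)μ(n+h)/n| ≤ ε log x` for large `x`.

## References
* T. Tao, *The logarithmically averaged Chowla and Elliott conjectures for two-point
  correlations*, Forum Math. Pi 4 (2016), e8; arXiv:1509.05422. §1 (Theorem 1.2, Corollary 1.5 and
  the paragraph after Remark 1.6: "Corollary 1.5 also implies … when … at least one of `g₁, g₂` is
  equal to the Möbius function").
* The squarefree sieve `μ = λ · (1 ∗ μ∘√)` is folklore (e.g. the standard deduction of
  `∑ μ(n)μ(n+h) = o(x)` from the Liouville case).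

## Design choices
* Everything is real-valued and stated over `Finset.Icc 1 x` to match the two `ParityWave0` facts
  verbatim; no new analytic input is used beyond `Literature.NumberTheory.Sieve.tao_log_chowla_liouville`.
* The helper definitions `Literature.NumberTheory.LFunctions.sqfreeInd`, `Literature.NumberTheory.LFunctions.lioPair`, `Literature.NumberTheory.LFunctions.sievedCorr`, `Literature.NumberTheory.LFunctions.mainDE`, `Literature.NumberTheory.LFunctions.tailD`,
  `Literature.NumberTheory.LFunctions.tailE` are bookkeeping abbreviations for this proof only.
* Reused from the tree: `Literature.NumberTheory.Sieve.abs_liouville_le_one` (`Sieve/ParityBarrier`, which re-exports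
  `ParityWave0`) and `Literature.NumberTheory.Sieve.sum_Icc_one_div_le_one_add_log` (`Sieve/PrimePowersInProgressions`).
-/

open Filter Asymptotics Finset
open scoped ArithmeticFunction.Moebius

namespace Literature.NumberTheory.LFunctions

/-! ### Part 1. Arithmetic input: `μ = λ · 𝟙_{squarefree}` and `𝟙_{squarefree}(n) = ∑_{d² ∣ n} μ(d)` -/

/-- The indicator of the squarefree numbers, as a real number. [folklore] -/
noncomputable def sqfreeInd (n : ℕ) : ℝ := if Squarefree n then 1 else 0

/-- `0 ≤ 𝟙_{sf}(n)`. [folklore] -/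
theorem sqfreeInd_nonneg (n : ℕ) : 0 ≤ sqfreeInd n := by
  unfold sqfreeInd; split_ifs <;> norm_num

/-- `𝟙_{sf}(n) ≤ 1`. [folklore] -/
theorem sqfreeInd_le_one (n : ℕ) : sqfreeInd n ≤ 1 := by
  unfold sqfreeInd; split_ifs <;> norm_num

/-- `|𝟙_{sf}(n)| ≤ 1`. [folklore] -/
theorem abs_sqfreeInd_le_one (n : ℕ) : |sqfreeInd n| ≤ 1 := by
  rw [abs_of_nonneg (sqfreeInd_nonneg n)]; exact sqfreeInd_le_one n

/-- `μ(n) = λ(n) · 𝟙_{squarefree}(n)`: the Möbius function is the Liouville function restricted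
to the squarefree numbers (both are `(-1)^{Ω(n)}` there). [folklore] -/
theorem moebius_eq_liouville_mul_sqfreeInd (n : ℕ) :
    (μ n : ℝ) = (ArithmeticFunction.liouville n : ℝ) * sqfreeInd n := by
  unfold sqfreeInd
  by_cases hn : Squarefree n
  · rw [if_pos hn, mul_one, ArithmeticFunction.moebius_apply_of_squarefree hn,
      ArithmeticFunction.liouville_apply hn.ne_zero]
  · rw [if_neg hn, mul_zero, ArithmeticFunction.moebius_eq_zero_of_not_squarefree hn]
    simp

/-- `|μ(n)| ≤ 1` (as a real number). [folklore] -/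
theorem abs_moebius_real_le_one (n : ℕ) : |(μ n : ℝ)| ≤ 1 := by
  rcases ArithmeticFunction.moebius_eq_or n with h | h | h <;> simp [h]

/-- For `a` squarefree and `b ≥ 1`: `d² ∣ b² a ↔ d ∣ b`. [folklore] -/
theorem sq_dvd_sq_mul_iff_of_squarefree {a b d : ℕ} (ha : Squarefree a) (hb : 0 < b) :
    d ^ 2 ∣ b ^ 2 * a ↔ d ∣ b := by
  refine ⟨fun h => ?_, fun h => (pow_dvd_pow_of_dvd h 2).mul_right a⟩
  have hg : 0 < d.gcd b := Nat.gcd_pos_of_pos_right _ hb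
  obtain ⟨g, d', b', hg0, hcop, rfl, rfl⟩ := Nat.exists_coprime' hg
  have h1 : d' ^ 2 ∣ b' ^ 2 * a := by
    rw [show (d' * g) ^ 2 = d' ^ 2 * g ^ 2 by ring,
      show (b' * g) ^ 2 * a = (b' ^ 2 * a) * g ^ 2 by ring] at h
    exact (Nat.mul_dvd_mul_iff_right (pow_pos hg0 2)).1 h
  have h2 : d' ^ 2 ∣ a := (Nat.Coprime.pow 2 2 hcop).dvd_of_dvd_mul_left h1
  have h3 : d' = 1 := Nat.isUnit_iff.1 (ha d' (by simpa [sq] using h2))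
  subst h3
  simp

/-- For `1 ≤ n ≤ N` with `n = b² a`, `a` squarefree: `{d ∈ [1, N] : d² ∣ n}` is the set of divisors
of `b`. [folklore] -/
theorem filter_sq_dvd_eq_divisors {n N a b : ℕ} (hab : b ^ 2 * a = n) (ha : Squarefree a)
    (hb : 0 < b) (hn : 0 < n) (hnN : n ≤ N) :
    (Icc 1 N).filter (fun d => d ^ 2 ∣ n) = b.divisors := by
  ext d
  simp only [mem_filter, mem_Icc, Nat.mem_divisors]
  constructor
  · rintro ⟨-, hd⟩
    exact ⟨(sq_dvd_sq_mul_iff_of_squarefree ha hb).1 (hab ▸ hd), hb.ne'⟩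
  · rintro ⟨hd, -⟩
    have hd2 : d ^ 2 ∣ n := hab ▸ (sq_dvd_sq_mul_iff_of_squarefree ha hb).2 hd
    refine ⟨⟨Nat.pos_of_dvd_of_pos hd hb, ?_⟩, hd2⟩
    calc d ≤ d ^ 2 := Nat.le_self_pow two_ne_zero d
      _ ≤ n := Nat.le_of_dvd hn hd2
      _ ≤ N := hnN

/-- **The squarefree sieve identity**: for `1 ≤ n ≤ N`,
`𝟙_{squarefree}(n) = ∑_{d ≤ N, d² ∣ n} μ(d)`. [folklore] -/
theorem sqfreeInd_eq_sum_moebius {n N : ℕ} (hn : 0 < n) (hnN : n ≤ N) :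
    sqfreeInd n = ∑ d ∈ (Icc 1 N).filter (fun d => d ^ 2 ∣ n), (μ d : ℝ) := by
  obtain ⟨a, b, -, hb, hab, ha⟩ := Nat.sq_mul_squarefree_of_pos hn
  rw [filter_sq_dvd_eq_divisors hab ha hb hn hnN]
  have key : ∑ d ∈ b.divisors, (μ d : ℝ) = if b = 1 then 1 else 0 := by
    have h1 := congrArg (fun f : ArithmeticFunction ℤ => f b)
      ArithmeticFunction.moebius_mul_coe_zeta
    simp only [ArithmeticFunction.coe_mul_zeta_apply, ArithmeticFunction.one_apply] at h1
    have h2 : ((∑ d ∈ b.divisors, μ d : ℤ) : ℝ) = ((if b = 1 then 1 else 0 : ℤ) : ℝ) := by rw [h1]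
    push_cast at h2
    exact h2
  rw [key, sqfreeInd]
  by_cases hb1 : b = 1
  · subst hb1
    have hna : n = a := by rw [← hab]; ring
    rw [if_pos (hna ▸ ha), if_pos rfl]
  · have hns : ¬Squarefree n := fun hsq =>
      hb1 (Nat.isUnit_iff.1 (hsq b ⟨a, by rw [← hab]; ring⟩))
    rw [if_neg hns, if_neg hb1]

/-! ### Part 2. Harmonic sums over well-separated sets -/

/-- If all elements of `S ⊆ [1, x]` are congruent modulo `q ≥ 1` and are `≥ b > 0`, then
`∑_{n ∈ S} 1/n ≤ 1/b + (1 + log x)/q`: the least element contributes at most `1/b`, and the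
`j`-th further element is at least `j q`. [folklore] -/
theorem sum_one_div_le_of_separated {S : Finset ℕ} {x q : ℕ} {b : ℝ} (hq : 0 < q) (hb : 0 < b)
    (hSx : ∀ n ∈ S, n ≤ x) (hsep : ∀ n ∈ S, ∀ n' ∈ S, n' ≤ n → q ∣ n - n')
    (hmin : ∀ n ∈ S, b ≤ n) :
    ∑ n ∈ S, (1 : ℝ) / n ≤ 1 / b + (1 + Real.log x) / q := by
  classical
  rcases S.eq_empty_or_nonempty with rfl | hne
  · simp only [sum_empty]
    have : 0 ≤ Real.log x := Real.log_natCast_nonneg x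
    positivity
  set m := S.min' hne with hm
  have hmS : m ∈ S := min'_mem S hne
  have hmle : ∀ n ∈ S, m ≤ n := fun n hn => min'_le S n hn
  have hk : ∀ n ∈ S.erase m,
      1 ≤ (n - m) / q ∧ (n - m) / q ≤ x ∧ q * ((n - m) / q) = n - m := by
    intro n hn
    obtain ⟨hnm, hnS⟩ := Finset.mem_erase.1 hn
    have hlt : m < n := lt_of_le_of_ne (hmle n hnS) (Ne.symm hnm)
    have hdvd : q ∣ n - m := hsep n hnS m hmS hlt.le
    refine ⟨?_, ?_, Nat.mul_div_cancel' hdvd⟩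
    · exact (Nat.le_div_iff_mul_le hq).2
        (by simpa using Nat.le_of_dvd (Nat.sub_pos_of_lt hlt) hdvd)
    · exact (Nat.div_le_self _ _).trans ((Nat.sub_le _ _).trans (hSx n hnS))
  rw [← Finset.add_sum_erase S _ hmS]
  refine add_le_add (one_div_le_one_div_of_le hb (hmin m hmS)) ?_
  calc ∑ n ∈ S.erase m, (1 : ℝ) / n
      ≤ ∑ n ∈ S.erase m, (1 / q) * (1 / (((n - m) / q : ℕ) : ℝ)) := by
        refine Finset.sum_le_sum fun n hn => ?_
        obtain ⟨h1, -, h3⟩ := hk n hn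
        have hsub : 0 < n - m := by
          have := (Nat.le_div_iff_mul_le hq).1 h1
          rw [one_mul] at this
          exact lt_of_lt_of_le hq this
        have hqk : (q : ℝ) * (((n - m) / q : ℕ) : ℝ) = ((n - m : ℕ) : ℝ) := by exact_mod_cast h3
        rw [one_div_mul_one_div, hqk]
        have hpos : (0 : ℝ) < ((n - m : ℕ) : ℝ) := by exact_mod_cast hsub
        exact one_div_le_one_div_of_le hpos (by exact_mod_cast Nat.sub_le n m)
    _ = (1 / q) * ∑ n ∈ S.erase m, (1 / (((n - m) / q : ℕ) : ℝ)) := by rw [Finset.mul_sum]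
    _ ≤ (1 / q) * ∑ k ∈ Icc 1 x, (1 : ℝ) / k := by
        gcongr
        rw [← Finset.sum_image (f := fun k : ℕ => (1 : ℝ) / k) (g := fun n => (n - m) / q)]
        · apply Finset.sum_le_sum_of_subset_of_nonneg
          · intro k hk'
            rw [Finset.mem_image] at hk'
            obtain ⟨n, hn, rfl⟩ := hk'
            exact Finset.mem_Icc.2 ⟨(hk n hn).1, (hk n hn).2.1⟩
          · intros; positivity
        · intro n hn n' hn' h
          have e1 := (hk n hn).2.2
          have e2 := (hk n' hn').2.2
          have hmn : m ≤ n := hmle n (Finset.mem_erase.1 hn).2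
          have hmn' : m ≤ n' := hmle n' (Finset.mem_erase.1 hn').2
          have : n - m = n' - m := by rw [← e1, ← e2]; exact congrArg (q * ·) h
          omega
    _ ≤ (1 / q) * (1 + Real.log x) := by gcongr; exact Sieve.sum_Icc_one_div_le_one_add_log x
    _ = (1 + Real.log x) / q := by ring

/-- `∑_{D < d ≤ N} 1/d² ≤ 1/D` for `D ≥ 1`. [folklore] -/
theorem sum_Ioc_one_div_sq_le {D N : ℕ} (hD : 1 ≤ D) :
    ∑ d ∈ Ioc D N, (1 : ℝ) / ((d : ℝ) ^ 2) ≤ 1 / D := by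
  rcases le_total D N with h | h
  · calc ∑ d ∈ Ioc D N, (1 : ℝ) / ((d : ℝ) ^ 2) = ∑ d ∈ Ioc D N, ((d : ℝ) ^ 2)⁻¹ := by
          simp [one_div]
      _ ≤ (D : ℝ)⁻¹ - (N : ℝ)⁻¹ := sum_Ioc_inv_sq_le_sub (by omega) h
      _ ≤ 1 / D := by rw [one_div]; exact sub_le_self _ (by positivity)
  · rw [Finset.Ioc_eq_empty (by omega), sum_empty]
    positivity

/-! ### Part 3. Rearrangements -/

/-- `∑_{n ∈ B} g(n) · ∑_{d ∈ A : P(d, n)} w(d) = ∑_{d ∈ A} w(d) · ∑_{n ∈ B : P(d, n)} g(n)`. [folklore] -/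
theorem sum_mul_sum_filter_comm {A B : Finset ℕ} (P : ℕ → ℕ → Prop) [∀ d n, Decidable (P d n)]
    (g w : ℕ → ℝ) :
    ∑ n ∈ B, g n * ∑ d ∈ A with P d n, w d = ∑ d ∈ A, w d * ∑ n ∈ B with P d n, g n := by
  simp only [Finset.sum_filter, Finset.mul_sum]
  rw [Finset.sum_comm]
  refine Finset.sum_congr rfl fun d _ => Finset.sum_congr rfl fun n _ => ?_
  split_ifs <;> ring

/-- `|∑_{d ∈ A} w(d) · ∑_{n ∈ B : P(d,n)} g(n)| ≤ ∑_{d ∈ A} ∑_{n ∈ B : P(d, n)} |g(n)|` when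
`|w| ≤ 1`. [folklore] -/
theorem abs_sum_mul_sum_filter_le {A B : Finset ℕ} (P : ℕ → ℕ → Prop) [∀ d n, Decidable (P d n)]
    (g w : ℕ → ℝ) (hw : ∀ d, |w d| ≤ 1) :
    |∑ d ∈ A, w d * ∑ n ∈ B with P d n, g n| ≤ ∑ d ∈ A, ∑ n ∈ B with P d n, |g n| := by
  refine (Finset.abs_sum_le_sum_abs _ _).trans (Finset.sum_le_sum fun d _ => ?_)
  rw [abs_mul]
  calc |w d| * |∑ n ∈ B with P d n, g n| ≤ 1 * ∑ n ∈ B with P d n, |g n| :=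
        mul_le_mul (hw d) (Finset.abs_sum_le_sum_abs _ _) (abs_nonneg _) zero_le_one
    _ = _ := one_mul _

/-- Splitting a sieve range: for `D ≤ N`,
`∑_{d ≤ N : P d} w(d) = ∑_{d ≤ D : P d} w(d) + ∑_{D < d ≤ N : P d} w(d)`. [folklore] -/
theorem sum_filter_Icc_split (P : ℕ → Prop) [DecidablePred P] (w : ℕ → ℝ) {D N : ℕ} (hD : D ≤ N) :
    ∑ d ∈ (Icc 1 N).filter P, w d
      = ∑ d ∈ (Icc 1 D).filter P, w d + ∑ d ∈ (Ioc D N).filter P, w d := by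
  have h1 : Icc 1 N = Ioc 0 N := by ext k; simp only [mem_Icc, mem_Ioc]; omega
  have h2 : Icc 1 D = Ioc 0 D := by ext k; simp only [mem_Icc, mem_Ioc]; omega
  simp only [Finset.sum_filter, h1, h2]
  exact (Finset.sum_Ioc_consecutive _ (Nat.zero_le D) hD).symm

/-! ### Part 4. The sieved Liouville correlations along a residue class -/

/-- The summand `λ(n) λ(n+h) / n` of the logarithmic two-point Liouville correlation. [folklore] -/
noncomputable def lioPair (h n : ℕ) : ℝ :=
  (ArithmeticFunction.liouville n : ℝ) * (ArithmeticFunction.liouville (n + h) : ℝ) / n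

/-- `|λ(n) λ(n+h) / n| ≤ 1/n`. [folklore] -/
theorem abs_lioPair_le (h n : ℕ) : |lioPair h n| ≤ 1 / n := by
  unfold lioPair
  rw [abs_div, abs_mul, Nat.abs_cast]
  refine div_le_div_of_nonneg_right ?_ (Nat.cast_nonneg n)
  calc |(ArithmeticFunction.liouville n : ℝ)| * |(ArithmeticFunction.liouville (n + h) : ℝ)|
      ≤ 1 * 1 := mul_le_mul (Sieve.abs_liouville_le_one _) (Sieve.abs_liouville_le_one _)
        (abs_nonneg _) zero_le_one
    _ = 1 := one_mul 1

/-- `|λ(n) λ(n+h) / n| ≤ 1`. [folklore] -/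
theorem abs_lioPair_le_one (h n : ℕ) : |lioPair h n| ≤ 1 := by
  refine (abs_lioPair_le h n).trans ?_
  rcases Nat.eq_zero_or_pos n with rfl | hn
  · simp
  · rw [div_le_one (by exact_mod_cast hn)]; exact_mod_cast hn

/-- The sieved two-point correlation
`T_{d,e}^{h}(x) = ∑_{n ≤ x : d² ∣ n, e² ∣ n + h} λ(n) λ(n+h) / n`. [folklore] -/
noncomputable def sievedCorr (d e h x : ℕ) : ℝ :=
  ∑ n ∈ (Icc 1 x).filter (fun n => d ^ 2 ∣ n ∧ e ^ 2 ∣ n + h), lioPair h n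

/-- Simultaneous congruences modulo `m` and `n` give a congruence modulo `lcm(m, n)`. [folklore] -/
theorem modEq_lcm {a b m n : ℕ} (h1 : a ≡ b [MOD m]) (h2 : a ≡ b [MOD n]) :
    a ≡ b [MOD Nat.lcm m n] := by
  rcases le_total a b with hab | hab
  · exact (Nat.modEq_iff_dvd' hab).2
      (Nat.lcm_dvd ((Nat.modEq_iff_dvd' hab).1 h1) ((Nat.modEq_iff_dvd' hab).1 h2))
  · exact ((Nat.modEq_iff_dvd' hab).2 (Nat.lcm_dvd ((Nat.modEq_iff_dvd' hab).1 h1.symm)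
      ((Nat.modEq_iff_dvd' hab).1 h2.symm))).symm

/-- The solutions `n` of `d² ∣ n`, `e² ∣ n + h` form a residue class modulo `lcm(d², e²)`
(Chinese remainder theorem), as soon as there is one solution `s`. [folklore] -/
theorem sq_dvd_and_sq_dvd_add_iff {d e h s : ℕ} (hs : d ^ 2 ∣ s ∧ e ^ 2 ∣ s + h) (n : ℕ) :
    (d ^ 2 ∣ n ∧ e ^ 2 ∣ n + h) ↔
      n % Nat.lcm (d ^ 2) (e ^ 2) = s % Nat.lcm (d ^ 2) (e ^ 2) := by
  constructor
  · rintro ⟨h1, h2⟩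
    have m1 : n ≡ s [MOD d ^ 2] :=
      (Nat.modEq_zero_iff_dvd.2 h1).trans (Nat.modEq_zero_iff_dvd.2 hs.1).symm
    have m2 : n ≡ s [MOD e ^ 2] :=
      Nat.ModEq.add_right_cancel' h
        ((Nat.modEq_zero_iff_dvd.2 h2).trans (Nat.modEq_zero_iff_dvd.2 hs.2).symm)
    exact modEq_lcm m1 m2
  · intro hn
    have m3 : n ≡ s [MOD Nat.lcm (d ^ 2) (e ^ 2)] := hn
    have m1 : n ≡ s [MOD d ^ 2] := m3.of_dvd (Nat.dvd_lcm_left _ _)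
    have m2 : n ≡ s [MOD e ^ 2] := m3.of_dvd (Nat.dvd_lcm_right _ _)
    exact ⟨(m1.dvd_iff dvd_rfl).2 hs.1, ((m2.add_right h).dvd_iff dvd_rfl).2 hs.2⟩

/-- A positive integer `n ≡ c (mod L)` with `1 ≤ c ≤ L` is of the form `L k + c`. [folklore] -/
theorem exists_eq_mul_add_of_mod_eq {L c n : ℕ} (hc1 : 1 ≤ c) (hcL : c ≤ L) (hn1 : 1 ≤ n)
    (hmod : n % L = c % L) : c ≤ n ∧ n = L * ((n - c) / L) + c := by
  have hL : 0 < L := lt_of_lt_of_le hc1 hcL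
  have hcn : c ≤ n := by
    by_contra hlt
    push Not at hlt
    have hnL : n < L := hlt.trans_le hcL
    rw [Nat.mod_eq_of_lt hnL] at hmod
    rcases hcL.lt_or_eq with h | h
    · rw [Nat.mod_eq_of_lt h] at hmod; omega
    · rw [h, Nat.mod_self] at hmod; omega
  have hdvd : L ∣ n - c := (Nat.modEq_iff_dvd' hcn).1 hmod.symm
  have := Nat.mul_div_cancel' hdvd
  exact ⟨hcn, by omega⟩

/-- Re-indexing a residue class: for `1 ≤ c ≤ L` and `c ≤ x`,
`{n ∈ [1, x] : n ≡ c (L)} = {L k + c : 0 ≤ k ≤ (x - c)/L}`. [folklore] -/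
theorem filter_mod_eq_image {L c x : ℕ} (hc1 : 1 ≤ c) (hcL : c ≤ L) (hcx : c ≤ x) :
    (Icc 1 x).filter (fun n => n % L = c % L)
      = (Icc 0 ((x - c) / L)).image (fun k => L * k + c) := by
  have hL : 0 < L := lt_of_lt_of_le hc1 hcL
  ext n
  simp only [mem_filter, mem_Icc, mem_image, Nat.zero_le, true_and]
  constructor
  · rintro ⟨⟨h1, h2⟩, hn⟩
    obtain ⟨hcn, hk⟩ := exists_eq_mul_add_of_mod_eq hc1 hcL h1 hn
    refine ⟨(n - c) / L, ?_, hk.symm⟩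
    rw [Nat.le_div_iff_mul_le hL]
    have := Nat.mul_div_cancel' ((Nat.modEq_iff_dvd' hcn).1 hn.symm)
    rw [Nat.mul_comm]
    omega
  · rintro ⟨k, hk, rfl⟩
    rw [Nat.le_div_iff_mul_le hL] at hk
    refine ⟨⟨le_add_left hc1, by rw [Nat.mul_comm]; omega⟩, by rw [Nat.mul_add_mod]⟩

/-- `‖log a‖ ≤ ‖log b‖` for naturals `a ≤ b`. [folklore] -/
theorem norm_log_natCast_le_of_le {a b : ℕ} (hab : a ≤ b) :
    ‖Real.log (a : ℝ)‖ ≤ ‖Real.log (b : ℝ)‖ := by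
  rcases Nat.eq_zero_or_pos a with rfl | ha
  · simp
  · rw [Real.norm_of_nonneg (Real.log_natCast_nonneg a),
      Real.norm_of_nonneg (Real.log_natCast_nonneg b)]
    exact Real.log_le_log (by exact_mod_cast ha) (by exact_mod_cast hab)

/-- A bounded-eventually function is `o(log x)` along `ℕ`. [folklore] -/
theorem isLittleO_log_of_eventually_abs_le {f : ℕ → ℝ} {C : ℝ}
    (hf : ∀ᶠ x : ℕ in atTop, |f x| ≤ C) : f =o[atTop] fun x : ℕ => Real.log x := by
  have h1 : f =O[atTop] fun _ : ℕ => (1 : ℝ) := by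
    refine Asymptotics.IsBigO.of_bound C ?_
    filter_upwards [hf] with x hx
    simpa using hx
  have h2 : (fun _ : ℕ => (1 : ℝ)) =o[atTop] fun x : ℕ => Real.log x := by
    refine Asymptotics.isLittleO_const_left.2 (Or.inr ?_)
    exact tendsto_norm_atTop_atTop.comp (Real.tendsto_log_atTop.comp tendsto_natCast_atTop_atTop)
  exact h1.trans_isLittleO h2

/-- `∑_{k=1}^{K} 1/k² ≤ 2`. [folklore] -/
theorem sum_Ioc_one_div_sq_le_two (K : ℕ) : ∑ k ∈ Ioc 0 K, (1 : ℝ) / ((k : ℝ) ^ 2) ≤ 2 := by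
  have h : Ioc 0 K = Ioo 0 (K + 1) := by ext k; simp only [mem_Ioc, mem_Ioo]; omega
  have := sum_Ioo_inv_sq_le (α := ℝ) 0 (K + 1)
  rw [← h] at this
  simp only [one_div, Nat.cast_zero, zero_add, div_one] at this ⊢
  exact this

/-- **The sieved correlations are `o(log x)` given the Liouville two-point theorem.**
For fixed `d, e, h ≥ 1`, the set `{n : d² ∣ n, e² ∣ n + h}` is empty or a residue class
`n ≡ c (mod L)`, `L = lcm(d², e²)`; writing `n = L k + c` and comparing the weight `1/(Lk + c)` with
`1/(Lk)` (total discrepancy `≤ 3`), `T_{d,e}^h(x)` is `L⁻¹ ∑_{k ≤ (x-c)/L} λ(Lk+c) λ(Lk+c+h)/k + O(1)`,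
and the last sum is `o(log x)` by `Literature.NumberTheory.Sieve.tao_log_chowla_liouville` applied to the linear
forms `L k + c`, `L k + (c + h)` (`L (c + h) ≠ L c`); the input is Tao 2016, Cor. 1.5 /
Thm 1.3 in the form `Literature.NumberTheory.Sieve.tao_log_chowla_liouville`. [folklore] -/
theorem sievedCorr_isLittleO (hLf : Sieve.tao_log_chowla_liouville) {d e h : ℕ} (hd : 1 ≤ d)
    (he : 1 ≤ e) (hh : 1 ≤ h) :
    (fun x : ℕ => sievedCorr d e h x) =o[atTop] fun x : ℕ => Real.log x := by
  classical
  set L := Nat.lcm (d ^ 2) (e ^ 2) with hLdef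
  have hL : 0 < L := Nat.lcm_pos (by positivity) (by positivity)
  by_cases hsol : ∃ s, d ^ 2 ∣ s ∧ e ^ 2 ∣ s + h
  swap
  · push Not at hsol
    refine (Asymptotics.isLittleO_zero (fun x : ℕ => Real.log x) atTop).congr' ?_ EventuallyEq.rfl
    refine Eventually.of_forall fun x => ?_
    simp only [sievedCorr]
    rw [Finset.sum_eq_zero]
    intro n hn
    rw [Finset.mem_filter] at hn
    exact absurd hn.2.2 (hsol n hn.2.1)
  obtain ⟨s, hs⟩ := hsol
  obtain ⟨c, hc1, hcL, hcs⟩ : ∃ c, 1 ≤ c ∧ c ≤ L ∧ c % L = s % L := by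
    by_cases h0 : s % L = 0
    · exact ⟨L, hL, le_rfl, by rw [Nat.mod_self, h0]⟩
    · exact ⟨s % L, Nat.pos_of_ne_zero h0, (Nat.mod_lt _ hL).le, Nat.mod_mod _ _⟩
  have hchar : ∀ n, (d ^ 2 ∣ n ∧ e ^ 2 ∣ n + h) ↔ n % L = c % L := fun n => by
    rw [hcs]; exact sq_dvd_and_sq_dvd_add_iff hs n
  -- the comparison sum, in the form produced by `tao_log_chowla_liouville`
  set G : ℕ → ℝ := fun K => ∑ k ∈ Icc 1 K,
    (ArithmeticFunction.liouville (L * k + c) * ArithmeticFunction.liouville (L * k + (c + h)) : ℝ)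
      / k with hGdef
  have hG : G =o[atTop] fun K : ℕ => Real.log K := by
    have hne : L * (c + h) ≠ L * c := by
      intro heq
      have := Nat.eq_of_mul_eq_mul_left hL heq
      omega
    exact hLf L L c (c + h) hL hL hne
  have hK : Tendsto (fun x : ℕ => (x - c) / L) atTop atTop := by
    refine tendsto_atTop_atTop.2 fun b => ⟨L * b + c, fun x hx => ?_⟩
    rw [Nat.le_div_iff_mul_le hL]
    rw [Nat.mul_comm] at hx
    omega
  -- Step 1: the main comparison `|T(x) - G((x-c)/L)/L| ≤ 3` for `x ≥ c`.
  have hdec : ∀ x : ℕ, c ≤ x → |sievedCorr d e h x - G ((x - c) / L) / L| ≤ 3 := by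
    intro x hcx
    set K := (x - c) / L with hKdef
    have hT : sievedCorr d e h x = lioPair h c + ∑ k ∈ Ioc 0 K, lioPair h (L * k + c) := by
      unfold sievedCorr
      rw [Finset.filter_congr (fun n _ => hchar n), filter_mod_eq_image hc1 hcL hcx,
        Finset.sum_image, ← Finset.Ioc_insert_left (Nat.zero_le K), Finset.sum_insert]
      · simp
      · simp
      · intro k _ k' _ hkk'
        exact Nat.eq_of_mul_eq_mul_left hL (Nat.add_right_cancel hkk')
    have hGK : G K / L = ∑ k ∈ Ioc 0 K,
        (ArithmeticFunction.liouville (L * k + c) *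
          ArithmeticFunction.liouville (L * k + (c + h)) : ℝ) / k / L := by
      rw [hGdef]
      simp only
      rw [Finset.sum_div]
      rfl
    rw [hT, hGK, add_sub_assoc, ← Finset.sum_sub_distrib]
    refine (abs_add_le _ _).trans ?_
    have hhead : |lioPair h c| ≤ 1 := abs_lioPair_le_one h c
    have htail : |∑ k ∈ Ioc 0 K, (lioPair h (L * k + c) -
        (ArithmeticFunction.liouville (L * k + c) *
          ArithmeticFunction.liouville (L * k + (c + h)) : ℝ) / k / L)| ≤ 2 := by
      refine (Finset.abs_sum_le_sum_abs _ _).trans ?_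
      refine le_trans (Finset.sum_le_sum fun k hk => ?_) (sum_Ioc_one_div_sq_le_two K)
      rw [Finset.mem_Ioc] at hk
      have hk1 : (1 : ℝ) ≤ k := by exact_mod_cast hk.1
      have hLr : (1 : ℝ) ≤ L := by exact_mod_cast hL
      have hcr : (c : ℝ) ≤ L := by exact_mod_cast hcL
      have hc0 : (0 : ℝ) ≤ c := Nat.cast_nonneg c
      set P : ℝ := (ArithmeticFunction.liouville (L * k + c) : ℝ) *
        (ArithmeticFunction.liouville (L * k + (c + h)) : ℝ) with hP
      have hPle : |P| ≤ 1 := by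
        rw [hP, abs_mul]
        exact mul_le_one₀ (Sieve.abs_liouville_le_one _) (abs_nonneg _)
          (Sieve.abs_liouville_le_one _)
      have h1 : lioPair h (L * k + c) = P / ((L : ℝ) * k + c) := by
        unfold lioPair
        rw [hP]
        push_cast
        ring_nf
      rw [h1, div_div]
      have hu : (0 : ℝ) < (L : ℝ) * k + c := by positivity
      have hv : (0 : ℝ) < (k : ℝ) * L := by positivity
      rw [div_sub_div _ _ hu.ne' hv.ne', abs_div, abs_of_pos (mul_pos hu hv)]
      have : |P * ((k : ℝ) * L) - ((L : ℝ) * k + c) * P| = |P| * c := by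
        rw [show P * ((k : ℝ) * L) - ((L : ℝ) * k + c) * P = -(P * c) by ring, abs_neg, abs_mul,
          abs_of_nonneg hc0]
      rw [this, div_le_div_iff₀ (mul_pos hu hv) (by positivity)]
      have hkL0 : (0 : ℝ) ≤ (L : ℝ) * (k : ℝ) ^ 2 := by positivity
      calc |P| * c * (k : ℝ) ^ 2 ≤ 1 * L * (k : ℝ) ^ 2 := by gcongr
        _ = 1 * ((L : ℝ) * (k : ℝ) ^ 2) := by ring
        _ ≤ (L : ℝ) * ((L : ℝ) * (k : ℝ) ^ 2) := by gcongr
        _ = ((L : ℝ) * k + 0) * (k * L) := by ring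
        _ ≤ ((L : ℝ) * k + c) * (k * L) := by gcongr
        _ = 1 * (((L : ℝ) * k + c) * (k * L)) := by ring
    linarith
  -- Step 2: conclude.
  have h1 : (fun x : ℕ => G ((x - c) / L) / L) =o[atTop] fun x : ℕ => Real.log x := by
    have h2 : (G ∘ fun x : ℕ => (x - c) / L) =o[atTop]
        ((fun K : ℕ => Real.log K) ∘ fun x : ℕ => (x - c) / L) := hG.comp_tendsto hK
    have h3 : ((fun K : ℕ => Real.log K) ∘ fun x : ℕ => (x - c) / L) =O[atTop]
        fun x : ℕ => Real.log x := by
      refine Asymptotics.isBigO_of_le _ fun x => ?_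
      simp only [Function.comp]
      rw [Real.norm_eq_abs, Real.norm_eq_abs, ← Real.norm_eq_abs, ← Real.norm_eq_abs]
      exact norm_log_natCast_le_of_le ((Nat.div_le_self _ _).trans (Nat.sub_le _ _))
    have h4 := (h2.trans_isBigO h3).const_mul_left (1 / (L : ℝ))
    refine h4.congr_left fun x => ?_
    simp only [Function.comp]
    ring
  have h2 : (fun x : ℕ => sievedCorr d e h x - G ((x - c) / L) / L) =o[atTop]
      fun x : ℕ => Real.log x :=
    isLittleO_log_of_eventually_abs_le (C := 3)
      (Filter.eventually_atTop.2 ⟨c, fun x hx => hdec x hx⟩)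
  exact (h1.add h2).congr_left fun x => by ring

/-! ### Part 5. The squarefree sieve applied to `∑ μ(n) μ(n+h) / n` -/

/-- Main term of the sieve decomposition:
`M_{D,E}(x) = ∑_{d ≤ D} μ(d) ∑_{e ≤ E} μ(e) T_{d,e}^h(x)`. [folklore] -/
noncomputable def mainDE (h D E x : ℕ) : ℝ :=
  ∑ d ∈ Icc 1 D, (μ d : ℝ) * ∑ e ∈ Icc 1 E, (μ e : ℝ) * sievedCorr d e h x

/-- Tail of the sieve decomposition over large `d`:
`R_D(x) = ∑_{D < d ≤ x} μ(d) ∑_{n ≤ x, d² ∣ n} λ(n) λ(n+h) 𝟙_{sf}(n+h) / n`. [folklore] -/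
noncomputable def tailD (h D x : ℕ) : ℝ :=
  ∑ d ∈ Ioc D x, (μ d : ℝ) *
    ∑ n ∈ (Icc 1 x).filter (fun n => d ^ 2 ∣ n), lioPair h n * sqfreeInd (n + h)

/-- Tail of the sieve decomposition over small `d` and large `e`:
`R'_{D,E}(x) = ∑_{d ≤ D} μ(d) ∑_{E < e ≤ x + h} μ(e) ∑_{n ≤ x, d² ∣ n, e² ∣ n + h} λ(n) λ(n+h) / n`.
[folklore] -/
noncomputable def tailE (h D E x : ℕ) : ℝ :=
  ∑ d ∈ Icc 1 D, (μ d : ℝ) * ∑ e ∈ Ioc E (x + h), (μ e : ℝ) *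
    ∑ n ∈ ((Icc 1 x).filter (fun n => d ^ 2 ∣ n)).filter (fun n => e ^ 2 ∣ n + h), lioPair h n

/-- **Sieve decomposition.** For `D ≤ x` and `E ≤ x + h`,
`∑_{n ≤ x} μ(n) μ(n+h) / n = M_{D,E}(x) + R'_{D,E}(x) + R_D(x)`, obtained from
`μ(n) μ(n+h) = λ(n) λ(n+h) 𝟙_{sf}(n) 𝟙_{sf}(n+h)` by expanding `𝟙_{sf}(n) = ∑_{d² ∣ n} μ(d)`
(split at `D`) and then, for `d ≤ D`, `𝟙_{sf}(n+h) = ∑_{e² ∣ n+h} μ(e)` (split at `E`). [folklore] -/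
theorem moebius_corr_decomposition {h D E x : ℕ} (hDx : D ≤ x) (hEx : E ≤ x + h) :
    ∑ n ∈ Icc 1 x, (μ n : ℝ) * (μ (n + h) : ℝ) / n
      = mainDE h D E x + tailE h D E x + tailD h D x := by
  classical
  -- Step A/B: `μ(n) μ(n+h)/n = (λλ/n · 𝟙_sf(n+h)) · ∑_{d ≤ x, d² ∣ n} μ(d)`, split at `D`.
  have hAB : ∀ n ∈ Icc 1 x, (μ n : ℝ) * (μ (n + h) : ℝ) / n
      = (lioPair h n * sqfreeInd (n + h)) *
          ∑ d ∈ (Icc 1 D).filter (fun d => d ^ 2 ∣ n), (μ d : ℝ)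
        + (lioPair h n * sqfreeInd (n + h)) *
          ∑ d ∈ (Ioc D x).filter (fun d => d ^ 2 ∣ n), (μ d : ℝ) := by
    intro n hn
    rw [Finset.mem_Icc] at hn
    rw [← mul_add, ← sum_filter_Icc_split _ _ hDx, ← sqfreeInd_eq_sum_moebius hn.1 hn.2,
      moebius_eq_liouville_mul_sqfreeInd, moebius_eq_liouville_mul_sqfreeInd, lioPair]
    ring
  rw [Finset.sum_congr rfl hAB, Finset.sum_add_distrib,
    sum_mul_sum_filter_comm (fun d n => d ^ 2 ∣ n), sum_mul_sum_filter_comm (fun d n => d ^ 2 ∣ n)]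
  -- Step C: for `d ≤ D`, expand `𝟙_sf(n+h)` and split at `E`.
  have hC : ∀ d ∈ Icc 1 D,
      ∑ n ∈ (Icc 1 x).filter (fun n => d ^ 2 ∣ n), lioPair h n * sqfreeInd (n + h)
        = ∑ e ∈ Icc 1 E, (μ e : ℝ) * sievedCorr d e h x
          + ∑ e ∈ Ioc E (x + h), (μ e : ℝ) *
              ∑ n ∈ ((Icc 1 x).filter (fun n => d ^ 2 ∣ n)).filter (fun n => e ^ 2 ∣ n + h),
                lioPair h n := by
    intro d _
    have h1 : ∀ n ∈ (Icc 1 x).filter (fun n => d ^ 2 ∣ n), lioPair h n * sqfreeInd (n + h)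
        = lioPair h n * ∑ e ∈ (Icc 1 E).filter (fun e => e ^ 2 ∣ n + h), (μ e : ℝ)
          + lioPair h n * ∑ e ∈ (Ioc E (x + h)).filter (fun e => e ^ 2 ∣ n + h), (μ e : ℝ) := by
      intro n hn
      have hn' := Finset.mem_Icc.1 (Finset.mem_filter.1 hn).1
      rw [sqfreeInd_eq_sum_moebius (n := n + h) (N := x + h) (by omega) (by omega),
        sum_filter_Icc_split _ _ hEx, mul_add]
    rw [Finset.sum_congr rfl h1, Finset.sum_add_distrib,
      sum_mul_sum_filter_comm (fun e n => e ^ 2 ∣ n + h),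
      sum_mul_sum_filter_comm (fun e n => e ^ 2 ∣ n + h)]
    congr 1
    refine Finset.sum_congr rfl fun e _ => ?_
    rw [sievedCorr, Finset.filter_filter]
  rw [Finset.sum_congr rfl fun d hd => by rw [hC d hd]]
  simp only [mul_add, Finset.sum_add_distrib]
  rfl

/-- **Tail bound over large `d`**: `|R_D(x)| ≤ (2 + log x) / D`, since
`∑_{n ≤ x, d² ∣ n} 1/n ≤ (2 + log x)/d²` and `∑_{d > D} d⁻² ≤ 1/D`. [folklore] -/
theorem abs_tailD_le {h D x : ℕ} (hD : 1 ≤ D) : |tailD h D x| ≤ (2 + Real.log x) / D := by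
  classical
  unfold tailD
  refine (abs_sum_mul_sum_filter_le (fun d n => d ^ 2 ∣ n) _ _ abs_moebius_real_le_one).trans ?_
  have hlog : 0 ≤ Real.log x := Real.log_natCast_nonneg x
  calc ∑ d ∈ Ioc D x, ∑ n ∈ (Icc 1 x).filter (fun n => d ^ 2 ∣ n),
          |lioPair h n * sqfreeInd (n + h)|
      ≤ ∑ d ∈ Ioc D x, (2 + Real.log x) * (1 / (d : ℝ) ^ 2) := by
        refine Finset.sum_le_sum fun d hd => ?_
        rw [Finset.mem_Ioc] at hd
        have hd0 : 0 < d := by omega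
        calc ∑ n ∈ (Icc 1 x).filter (fun n => d ^ 2 ∣ n), |lioPair h n * sqfreeInd (n + h)|
            ≤ ∑ n ∈ (Icc 1 x).filter (fun n => d ^ 2 ∣ n), (1 : ℝ) / n := by
              refine Finset.sum_le_sum fun n _ => ?_
              rw [abs_mul]
              calc |lioPair h n| * |sqfreeInd (n + h)| ≤ (1 / n) * 1 :=
                    mul_le_mul (abs_lioPair_le h n) (abs_sqfreeInd_le_one _) (abs_nonneg _)
                      (by positivity)
                _ = 1 / n := mul_one _
          _ ≤ 1 / ((d : ℝ) ^ 2) + (1 + Real.log x) / ((d ^ 2 : ℕ) : ℝ) := by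
              refine sum_one_div_le_of_separated (q := d ^ 2) (b := (d : ℝ) ^ 2) (by positivity)
                (by positivity) ?_ ?_ ?_
              · intro n hn
                exact (Finset.mem_Icc.1 (Finset.mem_filter.1 hn).1).2
              · intro n hn n' hn' _
                exact Nat.dvd_sub (Finset.mem_filter.1 hn).2 (Finset.mem_filter.1 hn').2
              · intro n hn
                have h1 := Finset.mem_filter.1 hn
                have : d ^ 2 ≤ n := Nat.le_of_dvd (Finset.mem_Icc.1 h1.1).1 h1.2
                exact_mod_cast this
          _ = (2 + Real.log x) * (1 / (d : ℝ) ^ 2) := by push_cast; ring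
    _ = (2 + Real.log x) * ∑ d ∈ Ioc D x, 1 / (d : ℝ) ^ 2 := by rw [Finset.mul_sum]
    _ ≤ (2 + Real.log x) * (1 / D) := by gcongr; exact sum_Ioc_one_div_sq_le hD
    _ = (2 + Real.log x) / D := by ring

/-- **Tail bound over large `e`**: `|R'_{D,E}(x)| ≤ D (3 + log x) / E` for `E ≥ 2h`, since for
`e > E` the `n ≤ x` with `e² ∣ n + h` are `≥ e²/2` and lie in one residue class mod `e²`, so that
`∑ 1/n ≤ (3 + log x)/e²`, and `∑_{e > E} e⁻² ≤ 1/E`. [folklore] -/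
theorem abs_tailE_le {h D E x : ℕ} (hE : 1 ≤ E) (hhE : 2 * h ≤ E) :
    |tailE h D E x| ≤ D * ((3 + Real.log x) / E) := by
  classical
  unfold tailE
  refine (Finset.abs_sum_le_sum_abs _ _).trans ?_
  have hlog : 0 ≤ Real.log x := Real.log_natCast_nonneg x
  calc ∑ d ∈ Icc 1 D, |(μ d : ℝ) * ∑ e ∈ Ioc E (x + h), (μ e : ℝ) *
          ∑ n ∈ ((Icc 1 x).filter (fun n => d ^ 2 ∣ n)).filter (fun n => e ^ 2 ∣ n + h),
            lioPair h n|
      ≤ ∑ d ∈ Icc 1 D, (3 + Real.log x) / E := by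
        refine Finset.sum_le_sum fun d _ => ?_
        rw [abs_mul]
        refine (mul_le_of_le_one_left (abs_nonneg _) (abs_moebius_real_le_one d)).trans ?_
        refine (abs_sum_mul_sum_filter_le (fun e n => e ^ 2 ∣ n + h) _ _
          abs_moebius_real_le_one).trans ?_
        calc ∑ e ∈ Ioc E (x + h),
              ∑ n ∈ ((Icc 1 x).filter (fun n => d ^ 2 ∣ n)).filter (fun n => e ^ 2 ∣ n + h),
                |lioPair h n|
            ≤ ∑ e ∈ Ioc E (x + h), (3 + Real.log x) * (1 / (e : ℝ) ^ 2) := by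
              refine Finset.sum_le_sum fun e he => ?_
              rw [Finset.mem_Ioc] at he
              have he0 : 0 < e := by omega
              have he2 : 2 * h ≤ e ^ 2 :=
                calc 2 * h ≤ E := hhE
                  _ ≤ e := he.1.le
                  _ ≤ e ^ 2 := Nat.le_self_pow two_ne_zero e
              have he2r : (2 : ℝ) * h ≤ (e : ℝ) ^ 2 := by exact_mod_cast he2
              calc ∑ n ∈ ((Icc 1 x).filter (fun n => d ^ 2 ∣ n)).filter (fun n => e ^ 2 ∣ n + h),
                    |lioPair h n|
                  ≤ ∑ n ∈ ((Icc 1 x).filter (fun n => d ^ 2 ∣ n)).filter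
                      (fun n => e ^ 2 ∣ n + h), (1 : ℝ) / n :=
                    Finset.sum_le_sum fun n _ => abs_lioPair_le h n
                _ ≤ 1 / ((e : ℝ) ^ 2 / 2) + (1 + Real.log x) / ((e ^ 2 : ℕ) : ℝ) := by
                    refine sum_one_div_le_of_separated (q := e ^ 2) (b := (e : ℝ) ^ 2 / 2)
                      (by positivity) (by positivity) ?_ ?_ ?_
                    · intro n hn
                      exact (Finset.mem_Icc.1 (Finset.mem_filter.1 (Finset.mem_filter.1 hn).1).1).2
                    · intro n hn n' hn' _
                      have := Nat.dvd_sub (Finset.mem_filter.1 hn).2 (Finset.mem_filter.1 hn').2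
                      rwa [Nat.add_sub_add_right] at this
                    · intro n hn
                      have h1 := Finset.mem_filter.1 hn
                      have hn1 := (Finset.mem_Icc.1 (Finset.mem_filter.1 h1.1).1).1
                      have hle : e ^ 2 ≤ n + h := Nat.le_of_dvd (by omega) h1.2
                      have : ((e ^ 2 : ℕ) : ℝ) ≤ n + h := by exact_mod_cast hle
                      push_cast at this
                      linarith
                _ = (3 + Real.log x) * (1 / (e : ℝ) ^ 2) := by push_cast; ring
          _ = (3 + Real.log x) * ∑ e ∈ Ioc E (x + h), 1 / (e : ℝ) ^ 2 := by rw [Finset.mul_sum]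
          _ ≤ (3 + Real.log x) * (1 / E) := by gcongr; exact sum_Ioc_one_div_sq_le hE
          _ = (3 + Real.log x) / E := by ring
    _ = D * ((3 + Real.log x) / E) := by simp [Finset.sum_const, Nat.card_Icc]

/-- **The main term is `o(log x)`**, being a finite combination of the sieved correlations
`T_{d,e}^h`. [folklore] -/
theorem mainDE_isLittleO (hLf : Sieve.tao_log_chowla_liouville) {h : ℕ} (hh : 1 ≤ h) (D E : ℕ) :
    (fun x : ℕ => mainDE h D E x) =o[atTop] fun x : ℕ => Real.log x := by
  unfold mainDE
  refine Asymptotics.IsLittleO.sum fun d hd => ?_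
  refine Asymptotics.IsLittleO.const_mul_left ?_ _
  refine Asymptotics.IsLittleO.sum fun e he => ?_
  refine Asymptotics.IsLittleO.const_mul_left ?_ _
  exact sievedCorr_isLittleO hLf (Finset.mem_Icc.1 hd).1 (Finset.mem_Icc.1 he).1 hh

/-- **The Möbius two-point log-Chowla estimate follows from the Liouville one.**
`Literature.NumberTheory.Sieve.tao_log_chowla_liouville` (Tao 2016, Thm 1.2/Cor 1.5: two-point logarithmic
correlations of `λ` along linear forms `a₁ n + b₁`, `a₂ n + b₂`, `a₁ b₂ ≠ a₂ b₁`, are `o(log x)`)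
implies `Literature.NumberTheory.Sieve.tao_log_chowla_moebius` (`∑_{n ≤ x} μ(n) μ(n+h)/n = o(log x)` for every
`h ≥ 1`), by the squarefree sieve: `μ = λ 𝟙_{sf}`, `𝟙_{sf}(n) = ∑_{d² ∣ n} μ(d)`, truncation of
both sieves with tails `≤ (2 + log x)/D + D (3 + log x)/E`, and `o(log x)` for each of the
finitely many sieved correlations `T_{d,e}^h` (each a two-point correlation of `λ` along the
linear forms `L k + c`, `L k + c + h`, `L = lcm(d², e²)`). This is the reduction indicated in
Tao 2016, §1 (paragraph after Remark 1.6: the Möbius case of Corollary 1.5) carried out via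
`λ` rather than via Propositions 2.1–2.2 of the paper (the reduction itself is folklore).
[cite: TaoFMP2016, §1, paragraph after Remark 1.6] -/
theorem tao_log_chowla_moebius_of_liouville (hLf : Sieve.tao_log_chowla_liouville) :
    Sieve.tao_log_chowla_moebius := by
  intro h hh
  have main : (fun x : ℕ => ∑ n ∈ Icc 1 x, (μ n : ℝ) * (μ (n + h) : ℝ) / n) =o[atTop]
      fun x : ℕ => Real.log x := by
    refine Asymptotics.isLittleO_iff.2 fun c hc => ?_
    set D : ℕ := max 1 ⌈8 / c⌉₊ with hDdef
    set E : ℕ := max (2 * h) ⌈8 * (D : ℝ) / c⌉₊ with hEdef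
    have hD1 : 1 ≤ D := le_max_left _ _
    have hhE : 2 * h ≤ E := le_max_left _ _
    have hE1 : 1 ≤ E := le_trans (by omega) hhE
    have hDr : (1 : ℝ) / D ≤ c / 8 := by
      have h8 : (8 / c : ℝ) ≤ D := (Nat.le_ceil _).trans (by exact_mod_cast le_max_right _ _)
      calc (1 : ℝ) / D ≤ 1 / (8 / c) := one_div_le_one_div_of_le (by positivity) h8
        _ = c / 8 := one_div_div 8 c
    have hEr : (D : ℝ) / E ≤ c / 8 := by
      have h8' : ⌈8 * (D : ℝ) / c⌉₊ ≤ E := le_max_right _ _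
      have h8 : 8 * (D : ℝ) / c ≤ E := (Nat.le_ceil _).trans (by exact_mod_cast h8')
      have hDpos : (0 : ℝ) < D := by exact_mod_cast hD1
      calc (D : ℝ) / E ≤ D / (8 * (D : ℝ) / c) :=
          div_le_div_of_nonneg_left hDpos.le (by positivity) h8
        _ = c / 8 := by field_simp
    have hmain := Asymptotics.isLittleO_iff.1 (mainDE_isLittleO hLf hh D E) (half_pos hc)
    have hlog : ∀ᶠ x : ℕ in atTop, (5 / 2 : ℝ) ≤ Real.log x :=
      (Real.tendsto_log_atTop.comp tendsto_natCast_atTop_atTop).eventually (eventually_ge_atTop _)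
    filter_upwards [hmain, hlog, eventually_ge_atTop (max D E)] with x hxmain hxlog hxDE
    have hDx : D ≤ x := le_of_max_le_left hxDE
    have hEx : E ≤ x + h := (le_of_max_le_right hxDE).trans (Nat.le_add_right _ _)
    have hlog0 : 0 ≤ Real.log x := Real.log_natCast_nonneg x
    rw [Real.norm_of_nonneg hlog0] at hxmain
    rw [moebius_corr_decomposition hDx hEx, Real.norm_eq_abs, Real.norm_of_nonneg hlog0]
    have h1 : |tailD h D x| ≤ c / 8 * (2 + Real.log x) := (abs_tailD_le hD1).trans (by
      rw [div_eq_mul_one_div, mul_comm]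
      exact mul_le_mul_of_nonneg_right hDr (by linarith))
    have h2 : |tailE h D E x| ≤ c / 8 * (3 + Real.log x) := (abs_tailE_le hE1 hhE).trans (by
      rw [show (D : ℝ) * ((3 + Real.log x) / E) = D / E * (3 + Real.log x) by ring]
      exact mul_le_mul_of_nonneg_right hEr (by linarith))
    have h0 : |mainDE h D E x| ≤ c / 2 * Real.log x := by rwa [Real.norm_eq_abs] at hxmain
    calc |mainDE h D E x + tailE h D E x + tailD h D x|
        ≤ |mainDE h D E x| + |tailE h D E x| + |tailD h D x| := abs_add_three _ _ _
      _ ≤ c / 2 * Real.log x + c / 8 * (3 + Real.log x) + c / 8 * (2 + Real.log x) := by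
          gcongr
      _ ≤ c * Real.log x := by nlinarith [mul_nonneg hc.le (sub_nonneg.2 hxlog)]
  exact main

end Literature.NumberTheory.LFunctions
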